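import Summits.AnomalousDissipation.AnomalousDissipation.Theorems.TaylorCertificatesTargetImpliesSteadyDirect
import Literature.Analysis.FluidPDE.StatisticalSolutionEnergyEq

/-!
# `TaylorCertificates.FloorCertificateEnsembleCeiling` (stmt-AnomalousDissipation-14086) — negative side VI:
# kill shapes AT A FORCE (how a quiet / fat / warm steady family refutes `X` at that force)

The route's KILL CRITERIA and the crux numerics (Cruxes/FloorCertificateEnsembleCeiling/Disproof.lean §J, EnsembleCeiling
TRIAGE-r1-1 §N1/§N2) speak of steady BRANCHES of `NS_ν(f)`: a FAT branch (`|u_ν|² → ∞`, e.g. the resolved Beltrami-ray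
branch `u = h₊/(4π²ν) + O(ν)` of `f_GP`), a QUIET branch (`ν‖∇u_ν‖² → 0`), or a WARM branch (both: `|u| ≍ ν^{-1/3}`,
`ν‖∇u‖² ≍ ν^{1/3}`). This file (cdisprove seat `refuter-cdisprove-stmt-AnomalousDissipation-14086-g2-0`, 2026-08-16)
packages the Dirac weak duality of `TaylorCertificatesTargetImpliesSteadyDirect` into the three one-line kill shapes,
so that whoever CONSTRUCTS such a family for a force `f` closes `X` at `f` (i.e. `¬ (FLOOR ∧ CEILING family at f)`) by
a single application — and `X` itself once this is done for every admissible `f`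
(`Negative/SteadyPinch.target_false_of_quietOrFatSteadyStates`):

* `xAt_false_of_fat_steady_family` — steady states in `V` of unbounded energy at arbitrarily small `ν` kill `X` at `f`;
* `xAt_false_of_quiet_steady_family` — steady states in `V` of vanishing dissipation at arbitrarily small `ν` kill it;
* `xAt_false_of_quietOrFat_steady_family` — the per-`ν` disjunction (warm branches) kills it.
No sign or size hypothesis on the force is needed; def-free, imports only `TaylorCertificatesTargetImpliesSteadyDirect`.
-/

noncomputable section

set_option linter.dupNamespace false

open MeasureTheory UnitAddTorus Filter Topology
open scoped InnerProductSpace ENNReal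

namespace Summit.AnomalousDissipation.AnomalousDissipation.Theorems.FloorCertificateEnsembleCeiling.Negative

open Literature.Analysis.FunctionSpaces Literature.Analysis.FluidPDE
open Summit.AnomalousDissipation.AnomalousDissipation.Theses.TaylorCertificates
open Summit.AnomalousDissipation.AnomalousDissipation.Theorems.TargetImpliesSteadyDirect

/-- **A quiet-or-fat steady family kills `X` at its force.** If for every box `(ε₀, E)` and every `ν₀ > 0` the force
`f ∈ L²` has, at some `ν ∈ (0, ν₀)`, a steady weak solution `u ∈ V` of `NS_ν(f)` with `ν‖∇u‖² < ε₀` OR `|u|² > E`,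
then no `(ε₀, E, ν₀)` makes the FLOOR ∧ CEILING family of `X` hold at `f`: the floor makes every steady state in `V`
`ε₀`-loud (`floor_le_dissipation_of_steady`) and the ceiling makes it `E`-bounded (`norm_sq_le_of_ensemble_ceiling`). -/
theorem xAt_false_of_quietOrFat_steady_family {f : (UnitAddTorus (Fin 3) → EuclideanSpace ℝ (Fin 3))} (hf : MemLp f 2 volume)
    (hqf : ∀ ε₀ E ν₀ : ℝ, 0 < ε₀ → 0 < ν₀ → ∃ ν : ℝ, 0 < ν ∧ ν < ν₀ ∧
      ∃ u : Torus.energySpace (Fin 3), (u : Lp (EuclideanSpace ℝ (Fin 3)) 2 (volume : Measure (UnitAddTorus (Fin 3)))) ∈ Torus.energySpaceV (Fin 3) ∧ Torus.IsSteadyWeakSolution ν f u ∧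
        (ν * (Torus.eGradNormSq ((u : Lp (EuclideanSpace ℝ (Fin 3)) 2 (volume : Measure (UnitAddTorus (Fin 3)))) : UnitAddTorus (Fin 3) → EuclideanSpace ℝ (Fin 3))).toReal < ε₀ ∨ E < ‖u‖ ^ 2)) :
    ¬ ∃ (ε₀ E ν₀ : ℝ), 0 < ε₀ ∧ 0 < ν₀ ∧ ∀ ν : ℝ, 0 < ν → ν < ν₀ →
      (∃ (Φ₁ : Torus.CylindricalTest (Fin 3)) (θ₁ : ℝ), θ₁ ≤ 0 ∧ ∀ u : Torus.energySpace (Fin 3),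
        Torus.eGradNormSq ((u : Lp (EuclideanSpace ℝ (Fin 3)) 2 (volume : Measure (UnitAddTorus (Fin 3)))) : UnitAddTorus (Fin 3) → EuclideanSpace ℝ (Fin 3)) ≠ ⊤ →
        ‖u‖ ^ 2 ≤ 16 * (∫ x, ‖f x‖ ^ 2) / ν ^ 2 →
        ε₀ ≤ ν * (Torus.eGradNormSq ((u : Lp (EuclideanSpace ℝ (Fin 3)) 2 (volume : Measure (UnitAddTorus (Fin 3)))) : UnitAddTorus (Fin 3) → EuclideanSpace ℝ (Fin 3))).toReal + Torus.nsGeneratorPairing ν f u (Φ₁.grad u) +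
          2 * θ₁ * (Torus.pairing (u : Lp (EuclideanSpace ℝ (Fin 3)) 2 (volume : Measure (UnitAddTorus (Fin 3)))) f - ν * (Torus.eGradNormSq ((u : Lp (EuclideanSpace ℝ (Fin 3)) 2 (volume : Measure (UnitAddTorus (Fin 3)))) : UnitAddTorus (Fin 3) → EuclideanSpace ℝ (Fin 3))).toReal)) ∧
      (∀ μ : Measure (Torus.energySpace (Fin 3)), Torus.IsStationaryStatisticalSolution ν f μ →
        Integrable (fun v : Torus.energySpace (Fin 3) => ‖v‖ ^ 2) μ → Torus.ensembleEnergy μ ≤ E) := by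
  rintro ⟨ε₀, E, ν₀, hε₀, hν₀, h⟩
  obtain ⟨ν, hν, hνν₀, u, hV, hu, hq⟩ := hqf ε₀ E ν₀ hε₀ hν₀
  obtain ⟨⟨Φ₁, θ₁, -, hfloor⟩, hceil⟩ := h ν hν hνν₀
  have h1 := floor_le_dissipation_of_steady hν hf hfloor hV hu
  have h2 := norm_sq_le_of_ensemble_ceiling hν hf hceil hV hu
  rcases hq with hq | hq <;> linarith

/-- **A fat steady family kills `X` at its force**: steady weak solutions in `V` of energy exceeding any bound, at
arbitrarily small viscosity (e.g. a laminar-type branch `|u_ν| ≍ ν⁻¹` or a warm branch `|u_ν| ≍ ν^{-1/3}`), refute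
the CEILING half at `f` for every `E`, hence `X` at `f`. -/
theorem xAt_false_of_fat_steady_family {f : (UnitAddTorus (Fin 3) → EuclideanSpace ℝ (Fin 3))} (hf : MemLp f 2 volume)
    (hfat : ∀ E ν₀ : ℝ, 0 < ν₀ → ∃ ν : ℝ, 0 < ν ∧ ν < ν₀ ∧
      ∃ u : Torus.energySpace (Fin 3), (u : Lp (EuclideanSpace ℝ (Fin 3)) 2 (volume : Measure (UnitAddTorus (Fin 3)))) ∈ Torus.energySpaceV (Fin 3) ∧ Torus.IsSteadyWeakSolution ν f u ∧ E < ‖u‖ ^ 2) :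
    ¬ ∃ (ε₀ E ν₀ : ℝ), 0 < ε₀ ∧ 0 < ν₀ ∧ ∀ ν : ℝ, 0 < ν → ν < ν₀ →
      (∃ (Φ₁ : Torus.CylindricalTest (Fin 3)) (θ₁ : ℝ), θ₁ ≤ 0 ∧ ∀ u : Torus.energySpace (Fin 3),
        Torus.eGradNormSq ((u : Lp (EuclideanSpace ℝ (Fin 3)) 2 (volume : Measure (UnitAddTorus (Fin 3)))) : UnitAddTorus (Fin 3) → EuclideanSpace ℝ (Fin 3)) ≠ ⊤ →
        ‖u‖ ^ 2 ≤ 16 * (∫ x, ‖f x‖ ^ 2) / ν ^ 2 →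
        ε₀ ≤ ν * (Torus.eGradNormSq ((u : Lp (EuclideanSpace ℝ (Fin 3)) 2 (volume : Measure (UnitAddTorus (Fin 3)))) : UnitAddTorus (Fin 3) → EuclideanSpace ℝ (Fin 3))).toReal + Torus.nsGeneratorPairing ν f u (Φ₁.grad u) +
          2 * θ₁ * (Torus.pairing (u : Lp (EuclideanSpace ℝ (Fin 3)) 2 (volume : Measure (UnitAddTorus (Fin 3)))) f - ν * (Torus.eGradNormSq ((u : Lp (EuclideanSpace ℝ (Fin 3)) 2 (volume : Measure (UnitAddTorus (Fin 3)))) : UnitAddTorus (Fin 3) → EuclideanSpace ℝ (Fin 3))).toReal)) ∧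
      (∀ μ : Measure (Torus.energySpace (Fin 3)), Torus.IsStationaryStatisticalSolution ν f μ →
        Integrable (fun v : Torus.energySpace (Fin 3) => ‖v‖ ^ 2) μ → Torus.ensembleEnergy μ ≤ E) := by
  refine xAt_false_of_quietOrFat_steady_family hf fun ε₀ E ν₀ _ hν₀ => ?_
  obtain ⟨ν, hν, hνν₀, u, hV, hu, hE⟩ := hfat E ν₀ hν₀
  exact ⟨ν, hν, hνν₀, u, hV, hu, Or.inr hE⟩

/-- **A quiet steady family kills `X` at its force**: steady weak solutions in `V` of dissipation below any positive
bound, at arbitrarily small viscosity (e.g. the viscous continuation of a forced-Euler steady state `v` with `(f,v) = 0`,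
or a warm branch), refute the FLOOR half at `f` for every `ε₀ > 0`, hence `X` at `f`. -/
theorem xAt_false_of_quiet_steady_family {f : (UnitAddTorus (Fin 3) → EuclideanSpace ℝ (Fin 3))} (hf : MemLp f 2 volume)
    (hquiet : ∀ ε₀ ν₀ : ℝ, 0 < ε₀ → 0 < ν₀ → ∃ ν : ℝ, 0 < ν ∧ ν < ν₀ ∧
      ∃ u : Torus.energySpace (Fin 3), (u : Lp (EuclideanSpace ℝ (Fin 3)) 2 (volume : Measure (UnitAddTorus (Fin 3)))) ∈ Torus.energySpaceV (Fin 3) ∧ Torus.IsSteadyWeakSolution ν f u ∧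
        ν * (Torus.eGradNormSq ((u : Lp (EuclideanSpace ℝ (Fin 3)) 2 (volume : Measure (UnitAddTorus (Fin 3)))) : UnitAddTorus (Fin 3) → EuclideanSpace ℝ (Fin 3))).toReal < ε₀) :
    ¬ ∃ (ε₀ E ν₀ : ℝ), 0 < ε₀ ∧ 0 < ν₀ ∧ ∀ ν : ℝ, 0 < ν → ν < ν₀ →
      (∃ (Φ₁ : Torus.CylindricalTest (Fin 3)) (θ₁ : ℝ), θ₁ ≤ 0 ∧ ∀ u : Torus.energySpace (Fin 3),
        Torus.eGradNormSq ((u : Lp (EuclideanSpace ℝ (Fin 3)) 2 (volume : Measure (UnitAddTorus (Fin 3)))) : UnitAddTorus (Fin 3) → EuclideanSpace ℝ (Fin 3)) ≠ ⊤ →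
        ‖u‖ ^ 2 ≤ 16 * (∫ x, ‖f x‖ ^ 2) / ν ^ 2 →
        ε₀ ≤ ν * (Torus.eGradNormSq ((u : Lp (EuclideanSpace ℝ (Fin 3)) 2 (volume : Measure (UnitAddTorus (Fin 3)))) : UnitAddTorus (Fin 3) → EuclideanSpace ℝ (Fin 3))).toReal + Torus.nsGeneratorPairing ν f u (Φ₁.grad u) +
          2 * θ₁ * (Torus.pairing (u : Lp (EuclideanSpace ℝ (Fin 3)) 2 (volume : Measure (UnitAddTorus (Fin 3)))) f - ν * (Torus.eGradNormSq ((u : Lp (EuclideanSpace ℝ (Fin 3)) 2 (volume : Measure (UnitAddTorus (Fin 3)))) : UnitAddTorus (Fin 3) → EuclideanSpace ℝ (Fin 3))).toReal)) ∧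
      (∀ μ : Measure (Torus.energySpace (Fin 3)), Torus.IsStationaryStatisticalSolution ν f μ →
        Integrable (fun v : Torus.energySpace (Fin 3) => ‖v‖ ^ 2) μ → Torus.ensembleEnergy μ ≤ E) := by
  refine xAt_false_of_quietOrFat_steady_family hf fun ε₀ E ν₀ hε₀ hν₀ => ?_
  obtain ⟨ν, hν, hνν₀, u, hV, hu, hq⟩ := hquiet ε₀ ν₀ hε₀ hν₀
  exact ⟨ν, hν, hνν₀, u, hV, hu, Or.inl hq⟩

/-- The same, read on `X`: if EVERY admissible force carries a quiet-or-fat steady family, `X` is false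
(= `Negative.SteadyPinch.target_false_of_quietOrFatSteadyStates` without the `f ≠ 0` guard, which the hypothesis here
must then also cover at `f = 0` — it does: `u = 0` is the only steady state of unforced Navier–Stokes and is quiet). -/
theorem floorCertificateEnsembleCeiling_false_of_forall_quietOrFat_steady_family
    (hall : ∀ f : (UnitAddTorus (Fin 3) → EuclideanSpace ℝ (Fin 3)), Torus.IsSmooth f → Torus.IsDivFree f → Torus.HasZeroMean f →
      ∀ ε₀ E ν₀ : ℝ, 0 < ε₀ → 0 < ν₀ → ∃ ν : ℝ, 0 < ν ∧ ν < ν₀ ∧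
        ∃ u : Torus.energySpace (Fin 3), (u : Lp (EuclideanSpace ℝ (Fin 3)) 2 (volume : Measure (UnitAddTorus (Fin 3)))) ∈ Torus.energySpaceV (Fin 3) ∧ Torus.IsSteadyWeakSolution ν f u ∧
          (ν * (Torus.eGradNormSq ((u : Lp (EuclideanSpace ℝ (Fin 3)) 2 (volume : Measure (UnitAddTorus (Fin 3)))) : UnitAddTorus (Fin 3) → EuclideanSpace ℝ (Fin 3))).toReal < ε₀ ∨ E < ‖u‖ ^ 2)) :
    ¬ FloorCertificateEnsembleCeiling := by
  rintro ⟨f, hfs, hfd, hfz, ε₀, E, ν₀, hε₀, hν₀, h⟩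
  exact xAt_false_of_quietOrFat_steady_family (hfs.memLp 2) (hall f hfs hfd hfz) ⟨ε₀, E, ν₀, hε₀, hν₀, h⟩

end Summit.AnomalousDissipation.AnomalousDissipation.Theorems.FloorCertificateEnsembleCeiling.Negative

end
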